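import Summits.CriticalPhenomena.CardyFormulaZ2.Theorems.CardyComplexConeDefs
import Literature.Probability.LatticeModels.FKFreeArcPassage
import Literature.Probability.LatticeModels.MedialInterfaceMeasurability
import HarnessLib

/-!
# Duminil-Copin's Prop. 5 for the tree's medial exploration: the interface passes the touch corner at
# `x` iff `x` is joined to the wired arc (glue for line `iic-trace-flux-pairing`, stub S5)

Crux `ParafermionToSLESixFamilies` (stmt-CriticalPhenomena-11389), line `iic-trace-flux-pairing`, engine
S5 `stub_touchLawOfPairing`, step (ii): on the free (dual-wired) arc the modulus of the parafermion is
the monotone TOUCH PROBABILITY `P(x ↔ A)` (Duminil-Copin 2012, arXiv:1208.3787, Prop. 5: "the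
exploration path passes through the boundary medial edge at `x` if and only if `x` is connected to the
wired arc"; Duminil-Copin–Hongler–Nolin 2011, Lemma 12, for `q = 2`). This file proves it for the tree's
medial exploration `medialExploration E ω` of bond percolation on `ℤ²` in the H21 rendering
(`bcBondConfig`: every edge at an arc-`B` site closed), i.e. for the events entering the skeleton's
`touchProb E x = P{ω | ∃ y ∈ E.zdArcA, (openGraph (E.bcBondConfig ω)).Reachable x y}` and the corner
observable `cornerObs E δ x f` of `Theorems/CardyComplexConeDefs.lean`.

* `passesCorner_iff_exists_cornerOrbit_eq` — dictionary: the exploration list has the dart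
  `(cornerSource v f, cornerTarget v f)` at position `k` iff the `k`-th corner of the orbit of the start
  corner is the coded corner `(v, j)`, `f = faceAt v j`, and `k` is before the exit time.
* `exists_reachable_zdArcA_of_passesCorner` — (⇒, every admissible datum): a passed corner has its
  vertex joined to the arc `A` by open edges of the completed configuration (left-vertex invariant).
* `passesCorner_of_reachable` — (⇐): under (H1) "arc `A` connected through `Ω_δ`" and a chain of faces
  with closed common sides from the start face to `f` (the tree's PROVED separation theorem
  `exists_lt_exitTime_cornerOrbit_eq` of `Literature/…/FKFreeArcPassage.lean`, winding numbers of the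
  rounded interface cycle), `x ↔ A` forces the passage.
* `reflTransGen_freeSideAdj_of_zdArcB` — the chain exists between any two faces with arc-`B` corners as
  soon as (H2) the arc `B` is connected through lattice edges (faces around a `B`-site, and around two
  adjacent `B`-sites, share sides ending on `B`).
* `passesCorner_iff_reachable_of_touch` (registered glue) — DC12 Prop. 5 at every TOUCH CORNER
  (`f` inner with a corner on `B`): passage ⇔ `x ↔ A`; `real_passesCorner_eq_touchProb`: the passage
  probability IS the touch probability; `card_passages_le_one`, `norm_cornerObs_le_touchProb`: the corner
  is passed at most once, so `‖cornerObs E δ x f‖ ≤ P(x ↔ A)` with equality of `P(passage)` and `P(x ↔ A)`.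

(H1), (H2) hold eventually along discretisation families of a fixed rectilinear polygon (the discrete
boundary is one lattice row inside each side); they FAIL for annular carriers (triage r1-3: a wired hole),
where (⇐) is false. What is NOT here: the determinism of the winding phase at a touch corner (the cone
factor of step (ii); Hopf's Umlaufsatz for the prefix closed along the boundary, cf. the `q = 2` bottom-row
case `Literature/…/FKFreeArcPhase.lean`).
-/

noncomputable section

open scoped BigOperators
open MeasureTheory Filter Set
open Literature.Probability.LatticeModels Literature.Probability.Percolation
open Summit.CriticalPhenomena.CardyFormulaZ2.Cruxes.EdgePrecompact.QkzStripBoundaryArm (cornerObs)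

namespace Summit.CriticalPhenomena.CardyFormulaZ2.Cruxes.ParafermionToSLESixFamilies.IicTraceFluxPairing

/-! ### Dictionary: darts of the exploration list = orbit corners before the exit -/

section Dictionary

variable {E : DiscreteDobrushin} (hE : E.IsZdAdmissible) (ω : BondConfig (Site 2))

/-- **Dictionary.** For admissible data, the medial exploration has the dart of the coded corner `(v, j)`
(source `cornerSource v (faceAt v j)`, target `cornerTarget v (faceAt v j)`) at position `k` iff `k` is
before the exit time and the `k`-th corner of the orbit of the start corner is `(v, j)`. -/
theorem passesCornerAt_iff_cornerOrbit_eq (v : Site 2) (j : Fin 4) (k : ℕ) :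
    ((medialExploration E ω)[k]? = some (cornerSource v (faceAt v j)) ∧
        (medialExploration E ω)[k + 1]? = some (cornerTarget v (faceAt v j))) ↔
      k < DiscreteDobrushin.exitTime hE ω ∧
        cornerOrbit (E.bcBondConfig ω) (DiscreteDobrushin.startCorner hE) k = (v, j) := by
  rw [DiscreteDobrushin.medialExploration_eq_explorationList hE ω, cornerSource_faceAt, cornerTarget_faceAt]
  set N := DiscreteDobrushin.exitTime hE ω
  set c₀ := DiscreteDobrushin.startCorner hE
  have hlen := length_explorationList' (β := E.bcBondConfig ω) (c₀ := c₀) N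
  constructor
  · rintro ⟨h1, h2⟩
    obtain ⟨hk1, hk1'⟩ := List.getElem?_eq_some_iff.1 h1
    obtain ⟨hk2, hk2'⟩ := List.getElem?_eq_some_iff.1 h2
    rw [getElem_explorationList'] at hk1' hk2'
    rw [hlen] at hk2
    refine ⟨by omega, ?_⟩
    rw [cSrc_cornerOrbit_succ] at hk2'
    exact eq_of_cSrc_eq_of_cTgt_eq (q := (v, j)) hk1' hk2'
  · rintro ⟨hk, horb⟩
    refine ⟨List.getElem?_eq_some_iff.2 ⟨by rw [hlen]; omega, ?_⟩,
      List.getElem?_eq_some_iff.2 ⟨by rw [hlen]; omega, ?_⟩⟩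
    · rw [getElem_explorationList', horb]; rfl
    · rw [getElem_explorationList', cSrc_cornerOrbit_succ, horb]; rfl

/-- The dictionary, existential form: the exploration passes the corner `(v, faceAt v j)` iff some orbit
corner before the exit is `(v, j)`. -/
theorem passesCorner_iff_exists_cornerOrbit_eq (v : Site 2) (j : Fin 4) :
    (∃ k, (medialExploration E ω)[k]? = some (cornerSource v (faceAt v j)) ∧
        (medialExploration E ω)[k + 1]? = some (cornerTarget v (faceAt v j))) ↔
      ∃ k < DiscreteDobrushin.exitTime hE ω,
        cornerOrbit (E.bcBondConfig ω) (DiscreteDobrushin.startCorner hE) k = (v, j) := by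
  simp only [passesCornerAt_iff_cornerOrbit_eq hE ω]

include hE in
/-- **A corner is passed at most once**: two positions carrying the dart of `(v, f)` coincide (the orbit
does not repeat a corner before its exit, `cornerOrbit_ne`). -/
theorem passesCornerAt_unique {v f : Site 2} (hvf : IsCorner v f) {k k' : ℕ}
    (hk : (medialExploration E ω)[k]? = some (cornerSource v f) ∧
      (medialExploration E ω)[k + 1]? = some (cornerTarget v f))
    (hk' : (medialExploration E ω)[k']? = some (cornerSource v f) ∧
      (medialExploration E ω)[k' + 1]? = some (cornerTarget v f)) : k = k' := by
  obtain ⟨j, rfl⟩ := exists_faceAt_of_isCorner hvf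
  obtain ⟨h1, h1'⟩ := (passesCornerAt_iff_cornerOrbit_eq hE ω v j k).1 hk
  obtain ⟨h2, h2'⟩ := (passesCornerAt_iff_cornerOrbit_eq hE ω v j k').1 hk'
  have hc₀ := DiscreteDobrushin.isStartCorner_startCorner hE
  by_contra hne
  rcases Nat.lt_or_gt_of_ne hne with h | h
  · exact cornerOrbit_ne hE hc₀ h
      (fun i hi => DiscreteDobrushin.isInnerFace_of_lt_exitTime hE ω (lt_trans hi h2)) (h1'.trans h2'.symm)
  · exact cornerOrbit_ne hE hc₀ h
      (fun i hi => DiscreteDobrushin.isInnerFace_of_lt_exitTime hE ω (lt_trans hi h1)) (h2'.trans h1'.symm)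

end Dictionary

/-! ### (⇒) The vertex of a passed corner is joined to the wired arc -/

section Forward

variable {E : DiscreteDobrushin} {ω : BondConfig (Site 2)} {c₀ : Site 2 × Fin 4}

/-- **Left-vertex invariant, reachability form.** Along the orbit of the turning rule the left vertex
stays in the open cluster of the start vertex: following an open edge moves along it, crossing a closed
edge keeps the vertex. -/
theorem reachable_cornerOrbit_start (n : ℕ) :
    (openGraph (E.bcBondConfig ω)).Reachable (cornerOrbit (E.bcBondConfig ω) c₀ n).1 c₀.1 := by
  induction n with
  | zero => exact SimpleGraph.Reachable.refl _
  | succ n ih =>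
    rw [cornerOrbit_succ]
    by_cases h : cTgt (cornerOrbit (E.bcBondConfig ω) c₀ n) ∈ E.bcBondConfig ω
    · rw [nextCorner_of_mem h]
      refine SimpleGraph.Reachable.trans (SimpleGraph.Adj.reachable ?_) ih
      change (openGraph (E.bcBondConfig ω)).Adj
        ((cornerOrbit (E.bcBondConfig ω) c₀ n).1 + cornerUnit ((cornerOrbit (E.bcBondConfig ω) c₀ n).2 + 1))
        (cornerOrbit (E.bcBondConfig ω) c₀ n).1
      rw [openGraph_adj]
      refine ⟨by rw [Sym2.eq_swap]; exact h, fun heq =>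
        cornerUnit_ne_zero ((cornerOrbit (E.bcBondConfig ω) c₀ n).2 + 1) ?_⟩
      simpa using heq
    · rw [nextCorner_of_not_mem h]
      exact ih

/-- **(⇒) of DC12 Prop. 5, for every admissible datum and every corner.** If the medial exploration
passes the corner `(v, f)`, then `v` is joined to the discrete arc `A` by open edges of the completed
configuration (the event of `touchProb`). -/
theorem exists_reachable_zdArcA_of_passesCorner (hE : E.IsZdAdmissible) {v f : Site 2} (hvf : IsCorner v f)
    (h : ∃ k, (medialExploration E ω)[k]? = some (cornerSource v f) ∧
      (medialExploration E ω)[k + 1]? = some (cornerTarget v f)) :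
    ∃ a ∈ E.zdArcA, (openGraph (E.bcBondConfig ω)).Reachable v a := by
  obtain ⟨j, rfl⟩ := exists_faceAt_of_isCorner hvf
  obtain ⟨k, -, hk⟩ := (passesCorner_iff_exists_cornerOrbit_eq hE ω v j).1 h
  refine ⟨(DiscreteDobrushin.startCorner hE).1, (DiscreteDobrushin.isStartCorner_startCorner hE).mem_zdArcA, ?_⟩
  have := reachable_cornerOrbit_start (E := E) (ω := ω) (c₀ := DiscreteDobrushin.startCorner hE) k
  rwa [hk] at this

end Forward

/-! ### (⇐) A site joined to the wired arc forces the passage of its chained corners -/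

section Backward

variable {E : DiscreteDobrushin} (hE : E.IsZdAdmissible)

include hE in
/-- **(⇐) of DC12 Prop. 5** (the tree's separation theorem `exists_lt_exitTime_cornerOrbit_eq`, read
through the dictionary). Hypotheses: (H1) the arc `A` is connected through `Ω_δ`; `f` is an inner face
at `x` joined to the start face by a chain of adjacent faces whose common sides end on the arc `B`
(`FreeSideAdj`); `x ↔ A`. Conclusion: the exploration passes `(x, f)`. -/
theorem passesCorner_of_reachable
    (hA1 : ((discreteDomainGraph E.Ω E.δ).induce E.zdArcA).Preconnected)
    {x f : Site 2} (hxf : IsCorner x f) (hf : E.IsInnerFace f)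
    (hchain : Relation.ReflTransGen (FreeSideAdj E) (cFace (DiscreteDobrushin.startCorner hE)) f)
    {ω : BondConfig (Site 2)} (hreach : ∃ a ∈ E.zdArcA, (openGraph (E.bcBondConfig ω)).Reachable x a) :
    ∃ k, (medialExploration E ω)[k]? = some (cornerSource x f) ∧
      (medialExploration E ω)[k + 1]? = some (cornerTarget x f) := by
  obtain ⟨j, rfl⟩ := exists_faceAt_of_isCorner hxf
  rw [passesCorner_iff_exists_cornerOrbit_eq hE ω x j]
  obtain ⟨k, hk, hkq⟩ := exists_lt_exitTime_cornerOrbit_eq hE ω hA1 (x := x) (k := j) hf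
    (reflTransGen_closed_of_freeSideAdj hE ω hchain) hreach
  exact ⟨k, hk, hkq⟩

end Backward

/-! ### The chain of faces along the dual-wired arc -/

section Chain

variable {E : DiscreteDobrushin}

/-- Offset bookkeeping (decided on `Fin 4`): a common corner of the faces `j` and `j + 1` around a vertex
sits at offset `0` or `cornerUnit (j + 1)` from it. -/
theorem cornerOff_sub_eq_of_common (j i i' : Fin 4)
    (h : cornerOff i - cornerOff j = cornerOff i' - cornerOff (j + 1)) :
    cornerOff i - cornerOff j = 0 ∨ cornerOff i - cornerOff j = cornerUnit (j + 1) := by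
  revert j i i'
  decide

/-- The common corners of two consecutive faces around `b` are `b` and the far end of their shared side. -/
theorem eq_or_eq_of_isCorner_faceAt_succ {b y : Site 2} {j : Fin 4}
    (h1 : IsCorner y (faceAt b j)) (h2 : IsCorner y (faceAt b (j + 1))) :
    y = b ∨ y = b + cornerUnit (j + 1) := by
  obtain ⟨i, hi⟩ := exists_faceAt_of_isCorner h1
  obtain ⟨i', hi'⟩ := exists_faceAt_of_isCorner h2
  simp only [faceAt] at hi hi'
  have hy : y = b + (cornerOff i - cornerOff j) := by linear_combination -hi
  have hrel : cornerOff i - cornerOff j = cornerOff i' - cornerOff (j + 1) := by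
    linear_combination hi - hi'
  rcases cornerOff_sub_eq_of_common j i i' hrel with h0 | h0
  · left; rw [hy, h0, add_zero]
  · right; rw [hy, h0]

/-- Consecutive faces around an arc-`B` site are `FreeSideAdj` (their shared side ends at the site). -/
theorem freeSideAdj_faceAt_succ {b : Site 2} (hb : b ∈ E.zdArcB) (j : Fin 4) :
    FreeSideAdj E (faceAt b j) (faceAt b (j + 1)) := by
  -- the two faces differ by the unit vector `cornerUnit (j + 2)`, hence are adjacent dual vertices
  have hadj : (zdGraph 2).Adj (faceAt b j) (faceAt b (j + 1)) := by
    have h : faceAt b (j + 1) = faceAt b j + cornerUnit (j + 2) := by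
      rw [faceAt, faceAt, cornerUnit_add_two, cornerUnit_eq_off_sub]; abel
    rw [h]
    exact (SimpleGraph.mem_edgeSet _).1 (cSrc_mem_edgeSet (faceAt b j, j + 2))
  refine ⟨hadj, fun u w hu1 hu2 hw1 hw2 hne => ?_⟩
  rcases eq_or_eq_of_isCorner_faceAt_succ hu1 hu2 with rfl | hu
  · exact Or.inl hb
  · rcases eq_or_eq_of_isCorner_faceAt_succ hw1 hw2 with rfl | hw
    · exact Or.inr hb
    · exact absurd (hu.trans hw.symm) hne

/-- Going once more around the vertex: `j'` is one of `j, j+1, j+2, j+3` (decided). -/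
theorem fin4_eq_add (j j' : Fin 4) : j' = j ∨ j' = j + 1 ∨ j' = j + 1 + 1 ∨ j' = j + 1 + 1 + 1 := by
  revert j j'
  decide

/-- All faces around an arc-`B` site are chained. -/
theorem reflTransGen_freeSideAdj_faceAt {b : Site 2} (hb : b ∈ E.zdArcB) (j j' : Fin 4) :
    Relation.ReflTransGen (FreeSideAdj E) (faceAt b j) (faceAt b j') := by
  have step : ∀ i : Fin 4, Relation.ReflTransGen (FreeSideAdj E) (faceAt b i) (faceAt b (i + 1)) :=
    fun i => Relation.ReflTransGen.single (freeSideAdj_faceAt_succ hb i)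
  rcases fin4_eq_add j j' with rfl | rfl | rfl | rfl
  · exact Relation.ReflTransGen.refl
  · exact step j
  · exact (step j).trans (step (j + 1))
  · exact ((step j).trans (step (j + 1))).trans (step (j + 1 + 1))

/-- Faces around two lattice-adjacent arc-`B` sites are chained (through the two faces of their edge). -/
theorem reflTransGen_freeSideAdj_of_adj {b b' : Site 2} (hb : b ∈ E.zdArcB) (hb' : b' ∈ E.zdArcB)
    (hadj : (zdGraph 2).Adj b b') (j j' : Fin 4) :
    Relation.ReflTransGen (FreeSideAdj E) (faceAt b j) (faceAt b' j') := by
  obtain ⟨k, rfl⟩ := exists_eq_add_cornerUnit hadj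
  refine (reflTransGen_freeSideAdj_faceAt hb j k).trans ?_
  rw [← faceAt_add_unit_succ b k]
  exact reflTransGen_freeSideAdj_faceAt hb' (k + 1) j'

/-- **(H2) ⇒ the chain.** If the arc `B` is connected through lattice edges, any face with a corner on
`B` is joined to any other such face by a `FreeSideAdj`-chain. -/
theorem reflTransGen_freeSideAdj_of_zdArcB (hB1 : ((zdGraph 2).induce E.zdArcB).Preconnected)
    {b b' f f' : Site 2} (hb : b ∈ E.zdArcB) (hb' : b' ∈ E.zdArcB) (hf : IsCorner b f) (hf' : IsCorner b' f') :
    Relation.ReflTransGen (FreeSideAdj E) f f' := by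
  obtain ⟨j, rfl⟩ := exists_faceAt_of_isCorner hf
  obtain ⟨j', rfl⟩ := exists_faceAt_of_isCorner hf'
  obtain ⟨p⟩ := hB1 ⟨b, hb⟩ ⟨b', hb'⟩
  -- induction along a walk inside the arc `B`
  suffices H : ∀ (u v : E.zdArcB) (q : ((zdGraph 2).induce E.zdArcB).Walk u v) (i i' : Fin 4),
      Relation.ReflTransGen (FreeSideAdj E) (faceAt u.1 i) (faceAt v.1 i') from H _ _ p j j'
  intro u v q
  induction q with
  | @nil u => exact fun i i' => reflTransGen_freeSideAdj_faceAt u.2 i i'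
  | @cons u u' v hadj _ ih =>
    intro i i'
    rw [SimpleGraph.comap_adj, Function.Embedding.subtype_apply, Function.Embedding.subtype_apply] at hadj
    exact (reflTransGen_freeSideAdj_of_adj u.2 u'.2 hadj i 0).trans (ih 0 i')

end Chain

/-! ### DC12 Prop. 5 at touch corners; the passage probability is the touch probability -/

section Touch

/-- **Registered glue `passesCorner_iff_reachable_of_touch` — Duminil-Copin 2012, Prop. 5, for the
tree's medial exploration.** For admissible data with (H1) the arc `A` connected through `Ω_δ` and (H2)
the arc `B` connected through lattice edges, at every TOUCH CORNER `(x, f)` — `f` an inner face at `x`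
having a corner `u` on the dual-wired arc `B` — and every configuration: the exploration passes `(x, f)`
iff `x` is joined to the arc `A` by open edges of the completed configuration. -/
theorem passesCorner_iff_reachable_of_touch : ∀ (E : DiscreteDobrushin), E.IsZdAdmissible → ((discreteDomainGraph E.Ω E.δ).induce E.zdArcA).Preconnected → ((zdGraph 2).induce E.zdArcB).Preconnected → ∀ (x f : Site 2), IsCorner x f → E.IsInnerFace f → (∃ u : Site 2, IsCorner u f ∧ u ∈ E.zdArcB) → ∀ ω : BondConfig (Site 2), ((∃ k : ℕ, (medialExploration E ω)[k]? = some (cornerSource x f) ∧ (medialExploration E ω)[k + 1]? = some (cornerTarget x f)) ↔ ∃ y ∈ E.zdArcA, (openGraph (E.bcBondConfig ω)).Reachable x y) := by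
  intro E hE hA1 hB1 x f hxf hf hu ω
  refine ⟨exists_reachable_zdArcA_of_passesCorner hE hxf, fun hreach => ?_⟩
  obtain ⟨u, huf, huB⟩ := hu
  have hc₀ := DiscreteDobrushin.isStartCorner_startCorner hE
  refine passesCorner_of_reachable hE hA1 hxf hf ?_ hreach
  -- the start face has the corner `c₀.1 + cornerUnit c₀.2 ∈ B`
  exact reflTransGen_freeSideAdj_of_zdArcB hB1 hc₀.mem_zdArcB huB
    ((isCorner_add_faceAt_iff _ _ _).2 (Or.inl rfl)) huf

/-- The passage event of a corner is measurable (it is a function of the exploration). -/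
theorem measurableSet_passesCorner (E : DiscreteDobrushin) (v f : Site 2) :
    MeasurableSet {ω : BondConfig (Site 2) | ∃ k : ℕ, (medialExploration E ω)[k]? = some (cornerSource v f) ∧
      (medialExploration E ω)[k + 1]? = some (cornerTarget v f)} := by
  have h := measurable_of_medialExploration E
    (F := fun ω => ∃ k : ℕ, (medialExploration E ω)[k]? = some (cornerSource v f) ∧
      (medialExploration E ω)[k + 1]? = some (cornerTarget v f))
    (fun ω ω' hω => by simp only [hω])
  exact measurableSet_setOf.2 h

/-- **`P(passage at (x, f)) = P(x ↔ A)`** at a touch corner, under (H1), (H2): the passage probability of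
the corner observable's dart is the skeleton's `touchProb E x` (stated with `touchProb` unfolded). -/
theorem real_passesCorner_eq_touchProb {E : DiscreteDobrushin} (hE : E.IsZdAdmissible)
    (hA1 : ((discreteDomainGraph E.Ω E.δ).induce E.zdArcA).Preconnected)
    (hB1 : ((zdGraph 2).induce E.zdArcB).Preconnected)
    {x f : Site 2} (hxf : IsCorner x f) (hf : E.IsInnerFace f) (hu : ∃ u : Site 2, IsCorner u f ∧ u ∈ E.zdArcB) :
    (bondPercolation (zdGraph 2) half).real
        {ω | ∃ k : ℕ, (medialExploration E ω)[k]? = some (cornerSource x f) ∧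
          (medialExploration E ω)[k + 1]? = some (cornerTarget x f)} =
      (bondPercolation (zdGraph 2) half).real
        {ω | ∃ y ∈ E.zdArcA, (openGraph (E.bcBondConfig ω)).Reachable x y} := by
  congr 1
  ext ω
  exact passesCorner_iff_reachable_of_touch E hE hA1 hB1 x f hxf hf hu ω

end Touch

/-! ### The corner observable at a corner passed at most once -/

section Observable

variable {E : DiscreteDobrushin} (hE : E.IsZdAdmissible)

include hE in
/-- At most one position of the exploration carries the dart of the corner `(v, f)`. -/
theorem card_passages_le_one (ω : BondConfig (Site 2)) {v f : Site 2} (hvf : IsCorner v f) :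
    ((Finset.range (medialExploration E ω).length).filter (fun k =>
      (medialExploration E ω)[k]? = some (cornerSource v f) ∧
        (medialExploration E ω)[k + 1]? = some (cornerTarget v f))).card ≤ 1 := by
  refine Finset.card_le_one.2 fun k hk k' hk' => ?_
  rw [Finset.mem_filter] at hk hk'
  exact passesCornerAt_unique hE ω hvf hk.2 hk'.2

include hE in
/-- **`‖cornerObs E δ v f‖ ≤ P(passage at (v, f))`**: the integrand of the corner observable is a sum of
at most one unimodular phase. (With a deterministic phase at touch corners — the cone factor, not proved
here — this is an equality `‖cornerObs‖ = P(passage) = P(x ↔ A)`.) -/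
theorem norm_cornerObs_le_real_passesCorner (δ : ℝ) {v f : Site 2} (hvf : IsCorner v f) :
    ‖cornerObs E δ v f‖ ≤ (bondPercolation (zdGraph 2) half).real
      {ω | ∃ k : ℕ, (medialExploration E ω)[k]? = some (cornerSource v f) ∧
        (medialExploration E ω)[k + 1]? = some (cornerTarget v f)} := by
  set μ := bondPercolation (zdGraph 2) half
  set S := {ω : BondConfig (Site 2) | ∃ k : ℕ, (medialExploration E ω)[k]? = some (cornerSource v f) ∧
    (medialExploration E ω)[k + 1]? = some (cornerTarget v f)}
  have hS : MeasurableSet S := measurableSet_passesCorner E v f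
  -- pointwise bound of the integrand by the indicator of the passage event
  have hpt : ∀ ω, ‖(let γ := medialExploration E ω;
      ∑ k ∈ (Finset.range γ.length).filter (fun k => γ[k]? = some (cornerSource v f) ∧
        γ[k + 1]? = some (cornerTarget v f)),
        Complex.exp (-(Complex.I / 3) * ((Literature.Probability.LatticeModels.winding ((γ.map (medialPoint δ)).take (k + 2)) : ℝ) : ℂ)))‖ ≤
      S.indicator (fun _ => (1 : ℝ)) ω := by
    intro ω -- buildfix 2026-08-20: `winding` spelled as in `cornerObs` (CardyComplexConeDefs), not the `Polyline` copy
    simp only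
    refine (norm_sum_le _ _).trans ?_
    have h1 : ∀ k, ‖Complex.exp (-(Complex.I / 3) *
        ((Literature.Probability.LatticeModels.winding
          (((medialExploration E ω).map (medialPoint δ)).take (k + 2)) : ℝ) : ℂ))‖ = 1 := by
      intro k
      rw [Complex.norm_exp]
      simp
    simp only [h1, Finset.sum_const, nsmul_eq_mul, mul_one]
    by_cases hω : ω ∈ S
    · rw [Set.indicator_of_mem hω]
      exact_mod_cast card_passages_le_one hE ω hvf
    · rw [Set.indicator_of_notMem hω]
      have : ((Finset.range (medialExploration E ω).length).filter (fun k =>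
          (medialExploration E ω)[k]? = some (cornerSource v f) ∧
            (medialExploration E ω)[k + 1]? = some (cornerTarget v f))) = ∅ := by
        refine Finset.filter_eq_empty_iff.2 fun k _ hk => hω ⟨k, hk⟩
      rw [this, Finset.card_empty, Nat.cast_zero]
  calc ‖cornerObs E δ v f‖
      ≤ ∫ ω, S.indicator (fun _ => (1 : ℝ)) ω ∂μ := by
        unfold cornerObs
        exact norm_integral_le_of_norm_le ((integrable_const (1 : ℝ)).indicator hS)
          (Eventually.of_forall hpt)
    _ = μ.real S := by
        rw [integral_indicator hS, setIntegral_const, smul_eq_mul, mul_one]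

include hE in
/-- **At a touch corner, `‖cornerObs E δ x f‖ ≤ P(x ↔ A) = touchProb E x`** (under (H1), (H2)). -/
theorem norm_cornerObs_le_touchProb
    (hA1 : ((discreteDomainGraph E.Ω E.δ).induce E.zdArcA).Preconnected)
    (hB1 : ((zdGraph 2).induce E.zdArcB).Preconnected) (δ : ℝ)
    {x f : Site 2} (hxf : IsCorner x f) (hf : E.IsInnerFace f) (hu : ∃ u : Site 2, IsCorner u f ∧ u ∈ E.zdArcB) :
    ‖cornerObs E δ x f‖ ≤ (bondPercolation (zdGraph 2) half).real
      {ω | ∃ y ∈ E.zdArcA, (openGraph (E.bcBondConfig ω)).Reachable x y} := by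
  rw [← real_passesCorner_eq_touchProb hE hA1 hB1 hxf hf hu]
  exact norm_cornerObs_le_real_passesCorner hE δ hxf

end Observable

end Summit.CriticalPhenomena.CardyFormulaZ2.Cruxes.ParafermionToSLESixFamilies.IicTraceFluxPairing

end
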